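import Summits.Ventures.HodgeRepro2.T5SU11SphericalDecay

/-!
# The classical integral representation `Q_n(x) = P_n(x) ∫_x^∞ dy/((y² − 1) P_n(y)²)` for `x > 1`

Row 448 identified the Legendre function of the second kind with the decaying spherical solution,
`Q_n(cosh 2t) = 2 P_n(cosh 2t) ∫_t^∞ ds/(sinh 2s P_n(cosh 2s)²)`. The substitution `y = cosh 2s`
(`dy = 2 sinh 2s ds`, `y² − 1 = sinh² 2s`; Mathlib's improper change of variables `integral_comp_mul_deriv_Ioi`)
turns the tail integral into `½ ∫_{cosh 2t}^∞ dy/((y² − 1) P_n(y)²)` (`tailIntegral_eq_integral_legKernel`), and with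
`x = cosh 2t`, `t = ½ arcosh x`, gives the textbook formula

  **`Q_n(x) = P_n(x) ∫_x^∞ dy/((y² − 1) P_n(y)²)`** for `x > 1`  (`legQ2_eq_legP_mul_integral`),

the reduction-of-order representation of the second solution of Legendre's equation in the variable `x`. The
integrand `1/((y² − 1) P_n(y)²)` (`legKernel`) is positive and continuous on `(1, ∞)` and, since `P_n ≥ 1` there,
bounded by `x²/(x² − 1) · y⁻²` on `[x, ∞)`, hence integrable (`integrableOn_legKernel`). Nothing is claimed about (N).

Blind lane: Mathlib + the HodgeRepro2 prefix only; no sorry; axioms ⊆ {propext, Classical.choice,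
Quot.sound}.
-/

namespace Summit.Ventures.HodgeRepro2.T5SU11LegendreSecondKindIntegral

open Filter Topology MeasureTheory
open Set (Ioi Ici)
open T5SU11Cartan T5SU11SphericalFunction T5SU11SphericalLegendreAll T5SU11LegendreIdentities
  T5SU11LegendreSecondKind T5SU11SphericalSecondKind T5SU11SphericalLegendreHigher T5SU11ReductionOfOrder
  T5SU11ReductionOfOrderInfinity T5SU11SphericalSolutionSpaceAll T5SU11SphericalDecay

/-- The image of `[t, ∞)` under `cosh 2·` lies in `[cosh 2t, ∞)` for `t ≥ 0`. -/
theorem image_cosh_Ici_subset {t : ℝ} (ht : 0 ≤ t) :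
    (fun s => Real.cosh (2 * s)) '' Ici t ⊆ Ici (Real.cosh (2 * t)) := by
  rintro y ⟨s, hs, rfl⟩
  have hs' : t ≤ s := hs
  show Real.cosh (2 * t) ≤ Real.cosh (2 * s)
  rw [Real.cosh_le_cosh, abs_of_nonneg (by linarith), abs_of_nonneg (by linarith)]
  linarith

section measure

variable [MeasurableSpace Circle] [BorelSpace Circle]

/-- **The kernel** `1/((y² − 1) P_n(y)²)`. -/
noncomputable def legKernel (n : ℕ) (y : ℝ) : ℝ := 1 / ((y ^ 2 - 1) * legP n y ^ 2)

/-- The denominator `(y² − 1) P_n(y)²` is positive for `y > 1`. -/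
theorem legKernel_den_pos (n : ℕ) {y : ℝ} (hy : 1 < y) : 0 < (y ^ 2 - 1) * legP n y ^ 2 :=
  mul_pos (by nlinarith) (pow_pos (lt_of_lt_of_le one_pos (one_le_legP n hy.le)) 2)

/-- `legKernel n y > 0` for `y > 1`. -/
theorem legKernel_pos (n : ℕ) {y : ℝ} (hy : 1 < y) : 0 < legKernel n y :=
  div_pos one_pos (legKernel_den_pos n hy)

/-- The kernel is continuous on `(1, ∞)`. -/
theorem continuousOn_legKernel (n : ℕ) : ContinuousOn (legKernel n) (Ioi 1) := by
  intro y hy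
  have hy' : 1 < y := hy
  have hden : ContinuousAt (fun y => (y ^ 2 - 1) * legP n y ^ 2) y :=
    (((continuous_id.pow 2).sub continuous_const).mul ((continuous_legP n).pow 2)).continuousAt
  exact (continuousAt_const.div₀ hden (legKernel_den_pos n hy').ne').continuousWithinAt

/-- **The bound** `legKernel n y ≤ x²/(x² − 1) · y⁻²` for `1 < x ≤ y`. -/
theorem legKernel_le (n : ℕ) {x y : ℝ} (hx : 1 < x) (hxy : x ≤ y) :
    legKernel n y ≤ x ^ 2 / (x ^ 2 - 1) * (y ^ 2)⁻¹ := by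
  have hy : 1 < y := lt_of_lt_of_le hx hxy
  have hx0 : 0 < x ^ 2 - 1 := by nlinarith
  have hy0 : 0 < y := by linarith
  have hP : 1 ≤ legP n y ^ 2 := one_le_pow₀ (one_le_legP n hy.le)
  -- `(y² − 1) P_n(y)² ≥ y² (x² − 1)/x²`
  have hlow : y ^ 2 * (x ^ 2 - 1) / x ^ 2 ≤ (y ^ 2 - 1) * legP n y ^ 2 := by
    have h1 : y ^ 2 * (x ^ 2 - 1) / x ^ 2 ≤ y ^ 2 - 1 := by
      rw [div_le_iff₀ (by positivity)]
      nlinarith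
    calc y ^ 2 * (x ^ 2 - 1) / x ^ 2 ≤ y ^ 2 - 1 := h1
      _ = (y ^ 2 - 1) * 1 := (mul_one _).symm
      _ ≤ (y ^ 2 - 1) * legP n y ^ 2 := mul_le_mul_of_nonneg_left hP (by nlinarith)
  unfold legKernel
  calc 1 / ((y ^ 2 - 1) * legP n y ^ 2) ≤ 1 / (y ^ 2 * (x ^ 2 - 1) / x ^ 2) :=
        one_div_le_one_div_of_le (by positivity) hlow
    _ = x ^ 2 / (x ^ 2 - 1) * (y ^ 2)⁻¹ := by
        field_simp

/-- **The kernel is integrable on `(x, ∞)` for `x > 1`.** -/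
theorem integrableOn_legKernel (n : ℕ) {x : ℝ} (hx : 1 < x) : IntegrableOn (legKernel n) (Ioi x) := by
  have hx0 : 0 < x := by linarith
  have hmaj : IntegrableOn (fun y : ℝ => x ^ 2 / (x ^ 2 - 1) * y ^ (-2 : ℝ)) (Ioi x) :=
    (integrableOn_Ioi_rpow_of_lt (by norm_num) hx0).const_mul _
  refine hmaj.mono' ?_ ?_
  · exact ((continuousOn_legKernel n).mono (Set.Ioi_subset_Ioi hx.le)).aestronglyMeasurable measurableSet_Ioi
  · refine ae_restrict_of_forall_mem measurableSet_Ioi (fun y hy => ?_)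
    have hy : x < y := hy
    rw [Real.norm_eq_abs, abs_of_pos (legKernel_pos n (lt_trans hx hy)), Real.rpow_neg (by linarith), Real.rpow_two]
    exact legKernel_le n hx hy.le

/-- The kernel is integrable on `[x, ∞)` for `x > 1`. -/
theorem integrableOn_legKernel_Ici (n : ℕ) {x : ℝ} (hx : 1 < x) : IntegrableOn (legKernel n) (Ici x) :=
  (integrableOn_Ici_iff_integrableOn_Ioi).mpr (integrableOn_legKernel n hx)

/-- **The substitution identity**: `legKernel n (cosh 2s) · 2 sinh 2s = 2/(sinh 2s · φ_{2n+2}(a_s)²)` for `s > 0`. -/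
theorem legKernel_comp_cosh (n : ℕ) {s : ℝ} (hs : 0 < s) :
    legKernel n (Real.cosh (2 * s)) * (2 * Real.sinh (2 * s))
      = 2 * roIntegrand (fun t => sph (2 * (n : ℝ) + 2) (hyp t)) s := by
  have hS : Real.sinh (2 * s) ≠ 0 := (sinh_two_mul_pos hs).ne'
  have hc : 1 < Real.cosh (2 * s) := one_lt_cosh_two_mul hs.ne'
  have hP : legP n (Real.cosh (2 * s)) ≠ 0 := (lt_of_lt_of_le one_pos (one_le_legP n hc.le)).ne'
  have hcs : Real.cosh (2 * s) ^ 2 - 1 = Real.sinh (2 * s) ^ 2 := by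
    have := Real.cosh_sq (2 * s)
    linarith
  unfold legKernel roIntegrand
  simp only [sph_even_hyp]
  rw [hcs]
  field_simp

/-- **The change of variables `y = cosh 2s`**: `∫_t^∞ ds/(sinh 2s φ_{2n+2}(a_s)²) = ½ ∫_{cosh 2t}^∞ legKernel n`. -/
theorem tailIntegral_eq_integral_legKernel (n : ℕ) {t : ℝ} (ht : 0 < t) :
    tailIntegral (fun t => sph (2 * (n : ℝ) + 2) (hyp t)) t
      = (1 / 2) * ∫ y in Ioi (Real.cosh (2 * t)), legKernel n y := by
  have hlam : (1 : ℝ) < 2 * (n : ℝ) + 2 := by linarith [(Nat.cast_nonneg n : (0 : ℝ) ≤ n)]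
  have hc : 1 < Real.cosh (2 * t) := one_lt_cosh_two_mul ht.ne'
  have hint : IntegrableOn (roIntegrand fun t => sph (2 * (n : ℝ) + 2) (hyp t)) (Ioi t) :=
    integrableOn_roIntegrand_Ioi (hφ_sph _) (hpos_sph _) (integrableOn_roIntegrand_sph hlam) ht
  have hsub := integral_comp_mul_deriv_Ioi (f := fun s => Real.cosh (2 * s)) (f' := fun s => 2 * Real.sinh (2 * s))
    (g := legKernel n) (a := t)
    (Real.continuous_cosh.comp (continuous_const.mul continuous_id)).continuousOn
    tendsto_cosh_two_mul_atTop
    (fun s _ => (hasDerivAt_cosh_two_mul_self s).hasDerivWithinAt)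
    ((continuousOn_legKernel n).mono (by
      rintro y ⟨s, hs, rfl⟩
      have hs' : t < s := hs
      exact one_lt_cosh_two_mul (by linarith : s ≠ 0)))
    ((integrableOn_legKernel_Ici n hc).mono_set (image_cosh_Ici_subset ht.le))
    (by
      have h2 : IntegrableOn (fun s => 2 * roIntegrand (fun t => sph (2 * (n : ℝ) + 2) (hyp t)) s) (Ici t) :=
        (integrableOn_Ici_iff_integrableOn_Ioi).mpr (hint.const_mul 2)
      refine h2.congr_fun (fun s hs => ?_) measurableSet_Ici
      have hs' : t ≤ s := hs
      exact (legKernel_comp_cosh n (lt_of_lt_of_le ht hs')).symm)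
  -- the left side is `2 · tailIntegral`
  have hl : ∫ s in Ioi t, (legKernel n ∘ fun s => Real.cosh (2 * s)) s * (2 * Real.sinh (2 * s))
      = 2 * tailIntegral (fun t => sph (2 * (n : ℝ) + 2) (hyp t)) t := by
    unfold tailIntegral
    rw [← MeasureTheory.integral_const_mul]
    refine setIntegral_congr_fun measurableSet_Ioi (fun s hs => ?_)
    have hs' : t < s := hs
    exact legKernel_comp_cosh n (lt_trans ht hs')
  rw [hl] at hsub
  linarith

/-- **THE CLASSICAL FORMULA**: `Q_n(x) = P_n(x) ∫_x^∞ dy/((y² − 1) P_n(y)²)` for `x > 1`. -/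
theorem legQ2_eq_legP_mul_integral (n : ℕ) {x : ℝ} (hx : 1 < x) :
    legQ2 n x = legP n x * ∫ y in Ioi x, legKernel n y := by
  set t := Real.arcosh x / 2 with ht_def
  have ht : 0 < t := by
    have := Real.arcosh_pos hx
    positivity
  have hxt : Real.cosh (2 * t) = x := by
    rw [ht_def, show 2 * (Real.arcosh x / 2) = Real.arcosh x by ring, Real.cosh_arcosh hx.le]
  have h := sphQ_eq_two_mul_sphDecay n ht
  unfold sphQ sphDecay decaySolution at h
  rw [tailIntegral_eq_integral_legKernel n ht] at h
  simp only [sph_even_hyp] at h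
  rw [hxt] at h
  rw [h]
  ring

end measure

end Summit.Ventures.HodgeRepro2.T5SU11LegendreSecondKindIntegral
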